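import Mathlib
import Summits.NavierStokesRegularity.NavierStokesRegularity.Theorems.EulerZoomLiouvillePowerGaugeEulerLiouvilleAntiPeriodicMember
import HarnessLib

/-!
# Crux `EulerZoomLiouville.PowerGaugeEulerLiouville` (stmt-NavierStokesRegularity-19832), stub `stub_nonSelfSimilarRest`:
# wrong parity with ALMOST-EVERYWHERE hypotheses

Helper file (theorems only; `--supports stmt-NavierStokesRegularity-19832`; def-free).  Hand leafhand-ns-eulerzoomliouville-10 g3; a.e. forms of
`…AntiPeriodicMember` / `…WrongParityMember` (weak members are a.e.-defined objects, so the symmetry hypotheses should only be imposed a.e.):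

* `Loc.ae_eq_zero_of_aeNegPair` — master theorem with the partner equal to `−u` only a.e. on the past slab (modify the partner on a null set,
  `IsDistributionalNSSolutionOn.congr_ae`);
* `Birth.nonSelfSimilar_of_aeAntiEquivariantMember` — `u(τ, Rx) = −R u(τ, x)` for a.e. `(τ,x) ∈ (−∞,T₁) × ℝ³` ⇒ trivial (transport of the a.e.
  hypothesis along the measure-preserving `(s,x) ↦ (s, R⁻¹x)`).

WHAT THIS IS NOT: not a proof of the stub or of the crux; nothing about Navier–Stokes. [folklore]
-/

noncomputable section

-- flat `Theorems/<Route><Decl>…` files of one crux share the namespace of the crux (tree convention)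
set_option linter.dupNamespace false

open MeasureTheory Set Filter Topology Metric Function TopologicalSpace
open scoped RealInnerProductSpace NNReal ENNReal ContDiff

namespace Summit.NavierStokesRegularity.NavierStokesRegularity.Theorems.PowerGaugeEulerLiouville

open Literature.Analysis Literature.Analysis.FunctionSpaces Literature.Analysis.FluidPDE

/-! ## Almost-everywhere hypotheses -/

/-- **MASTER THEOREM, A.E. FORM.**  As `Loc.ae_eq_zero_of_negPair`, but the partner need only equal `−u` ALMOST EVERYWHERE on the past slab
`(−∞,T₁) × ℝ³` (the natural hypothesis for a.e.-defined weak fields): the partner is modified to `−u` on the past slab, which does not affect its being a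
distributional Euler pair (`IsDistributionalNSSolutionOn.congr_ae`). [folklore] -/
theorem Loc.ae_eq_zero_of_aeNegPair {ρ : ℝ} (hρ : 0 < ρ)
    {u u' : ℝ → EuclideanSpace ℝ (Fin 3) → EuclideanSpace ℝ (Fin 3)} {p p' : ℝ → EuclideanSpace ℝ (Fin 3) → ℝ}
    {H : ℝ → EuclideanSpace ℝ (Fin 3) → EuclideanSpace ℝ (Fin 3) →L[ℝ] EuclideanSpace ℝ (Fin 3)} {c : ℝ≥0}
    (hsw : IsSuitableWeakSolutionOn (slab (EuclideanSpace ℝ (Fin 3)) (Iio 0) isOpen_Iio) 0 0 u p)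
    (hH : HasWeakSpatialGradientOn (slab (EuclideanSpace ℝ (Fin 3)) (Iio 0) isOpen_Iio) u H)
    (hgauge : ∀ a : ℝ, 0 < a →
      ENNReal.ofReal (a ^ (2 * ρ)) * cknA a (0 : ℝ × EuclideanSpace ℝ (Fin 3)) u +
          ENNReal.ofReal (a ^ ρ) * cknE a (0 : ℝ × EuclideanSpace ℝ (Fin 3)) H +
        ENNReal.ofReal (a ^ (2 * ρ)) * cknD a (0 : ℝ × EuclideanSpace ℝ (Fin 3)) p ≤ (c : ℝ≥0∞))
    {T₀ T₁ : ℝ} (hT₀ : T₀ ≤ 0) (hT : T₁ ≤ T₀)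
    (hdist' : IsDistributionalNSSolutionOn (slab (EuclideanSpace ℝ (Fin 3)) (Iio T₀) isOpen_Iio) 0 0 u' p')
    (hneg : ∀ᵐ z ∂(volume.restrict (Iio T₁ ×ˢ (univ : Set (EuclideanSpace ℝ (Fin 3))))), u' z.1 z.2 = -u z.1 z.2) :
    uncurry u =ᵐ[volume.restrict (Iio (0 : ℝ) ×ˢ (univ : Set (EuclideanSpace ℝ (Fin 3))))] 0 := by
  classical
  set v : ℝ → EuclideanSpace ℝ (Fin 3) → EuclideanSpace ℝ (Fin 3) := fun τ x => if τ < T₁ then -u τ x else u' τ x with hv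
  have hvu' : ∀ᵐ z ∂(volume.restrict ((slab (EuclideanSpace ℝ (Fin 3)) (Iio T₀) isOpen_Iio : Opens (ℝ × EuclideanSpace ℝ (Fin 3))) :
      Set (ℝ × EuclideanSpace ℝ (Fin 3)))), uncurry u' z = uncurry v z := by
    rw [coe_slab]
    have h1 : ∀ᵐ z ∂(volume.restrict (Iio T₀ ×ˢ (univ : Set (EuclideanSpace ℝ (Fin 3))))),
        z ∈ Iio T₁ ×ˢ (univ : Set (EuclideanSpace ℝ (Fin 3))) → u' z.1 z.2 = -u z.1 z.2 :=
      ae_restrict_of_ae (ae_imp_of_ae_restrict hneg)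
    filter_upwards [h1] with z hz
    by_cases ht : z.1 < T₁
    · simp only [uncurry, hv, if_pos ht]
      exact hz ⟨ht, mem_univ _⟩
    · simp only [uncurry, hv, if_neg ht]
  have hdistv : IsDistributionalNSSolutionOn (slab (EuclideanSpace ℝ (Fin 3)) (Iio T₀) isOpen_Iio) 0 0 v p' :=
    hdist'.congr_ae hvu' (Eventually.of_forall fun _ => rfl)
  exact Loc.ae_eq_zero_of_negPair hρ hsw hH hgauge hT₀ hT hdistv fun τ hτ x => by simp only [hv, if_pos hτ]

/-- **Binder language, a.e. form: NO MEMBER IS A.E. ANTI-EQUIVARIANT UNDER A LINEAR ISOMETRY IN ITS FAR PAST** —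
`u(τ, Rx) = −R u(τ, x)` for a.e. `(τ, x) ∈ (−∞,T₁) × ℝ³` suffices. [folklore] -/
theorem Birth.nonSelfSimilar_of_aeAntiEquivariantMember :
    ∀ ρ : ℝ, 0 < ρ →
      ∀ (u : ℝ → EuclideanSpace ℝ (Fin 3) → EuclideanSpace ℝ (Fin 3)) (p : ℝ → EuclideanSpace ℝ (Fin 3) → ℝ)
        (H : ℝ → EuclideanSpace ℝ (Fin 3) → EuclideanSpace ℝ (Fin 3) →L[ℝ] EuclideanSpace ℝ (Fin 3)) (c : ℝ≥0),
        Birth.InClass ρ u p H c →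
          (∃ T₁ : ℝ, T₁ ≤ 0 ∧ ∃ R : EuclideanSpace ℝ (Fin 3) ≃ₗᵢ[ℝ] EuclideanSpace ℝ (Fin 3),
              ∀ᵐ z ∂(volume.restrict (Iio T₁ ×ˢ (univ : Set (EuclideanSpace ℝ (Fin 3))))), u z.1 (R z.2) = -(R (u z.1 z.2))) →
          uncurry u =ᵐ[volume.restrict (Iio (0 : ℝ) ×ˢ (univ : Set (EuclideanSpace ℝ (Fin 3))))] 0 := by
  intro ρ hρ u p H c hcl h
  obtain ⟨T₁, hT₁, R, hanti⟩ := h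
  have hconj := PressureSlaving.isDistributional_conj_isometry isOpen_Iio hcl.1.distributional R
  have hf0 : (fun (s : ℝ) (x : EuclideanSpace ℝ (Fin 3)) =>
      R ((0 : ℝ → EuclideanSpace ℝ (Fin 3) → EuclideanSpace ℝ (Fin 3)) s (R.symm x))) = 0 := by
    funext s x
    simp
  rw [hf0] at hconj
  refine Loc.ae_eq_zero_of_aeNegPair hρ hcl.1 hcl.2.1 hcl.2.2 le_rfl hT₁ hconj ?_
  -- transport the a.e. hypothesis along the measure-preserving map `(s, x) ↦ (s, R⁻¹ x)`
  set Ψ : ℝ × EuclideanSpace ℝ (Fin 3) → ℝ × EuclideanSpace ℝ (Fin 3) := fun z => (z.1, R.symm z.2) with hΨ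
  have hΨmp : MeasurePreserving Ψ
      (volume.restrict (Iio T₁ ×ˢ (univ : Set (EuclideanSpace ℝ (Fin 3)))))
      (volume.restrict (Iio T₁ ×ˢ (univ : Set (EuclideanSpace ℝ (Fin 3))))) := by
    have h1 := (PressureSlaving.measurePreserving_prod_isometry R.symm).restrict_preimage_emb
      (PressureSlaving.measurableEmbedding_prod_isometry R.symm) (Iio T₁ ×ˢ (univ : Set (EuclideanSpace ℝ (Fin 3))))
    rwa [PressureSlaving.preimage_prod_isometry_slab] at h1
  have h2 := hΨmp.quasiMeasurePreserving.tendsto_ae.eventually hanti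
  filter_upwards [h2] with z hz
  have hz' : u z.1 (R (R.symm z.2)) = -(R (u z.1 (R.symm z.2))) := hz
  rw [LinearIsometryEquiv.apply_symm_apply] at hz'
  rw [hz', neg_neg]

end Summit.NavierStokesRegularity.NavierStokesRegularity.Theorems.PowerGaugeEulerLiouville

end
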